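import Literature.AlgebraicGeometry.HilbertScheme.NakajimaOperators
import Literature.AlgebraicGeometry.Hyperkaehler.GeneralizedKummerType
import HarnessLib

/-!
# The Hilbert schemes of points of a smooth projective surface exist and are smooth projective
(Grothendieck, Fogarty — named fact) and the consequences for the lane-(V) carriers (proved)

Layer `Literature/AlgebraicGeometry/HilbertScheme`; rider on `HilbertSchemeOfPoints` (the predicate
`IsHilbertSchemeOfPoints n S H Ξ`: "the pair `(H, Ξ)` represents `Hilbⁿ_{S/ℂ}`", whose module docstring defers
the existence theorems to "whoever needs them") and on `NakajimaOperators` (the CHOICE structure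
`HilbertSchemesOfPoints S` of all `S^[n]`, `n ≥ 0`, each smooth projective of dimension `2n` — the carrier of the
Fock space `⨁ₙ H*(S^[n])`).

* NAMED FACT `Fogarty1968_hilbertScheme_surface` — for a smooth projective complex surface `S` and every `n`,
  there is a pair `(H, Ξ)` representing the Hilbert functor of `n` points of `S`, with `H` smooth projective
  (geometrically irreducible) of dimension `2n`.  EXISTENCE and PROJECTIVITY: Grothendieck, Séminaire Bourbaki
  221 (1960/61) (= FGA "TDTE IV: les schémas de Hilbert"), in the form of Nitsure's notes Thm. 5.1 ("Let `S` be
  a noetherian scheme, `π : X → S` a projective morphism […]. Then for any coherent `𝒪_X`-module `E` and any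
  polynomial `Φ ∈ ℚ[λ]`, the functor `Quot^{Φ,L}_{E/X/S}` is representable by a projective `S`-scheme" — `E = 𝒪_X`,
  `Φ = n`); SMOOTHNESS, IRREDUCIBILITY, DIMENSION: Fogarty, Amer. J. Math. 90 (1968) Thm. 2.4, as restated by
  Lehn, Invent. Math. 136 (1999) Thm. 1.1: "By a result of Grothendieck [Bourbaki221] `X^{[n]}` is again a
  projective scheme. […] Theorem 1.1 (Fogarty). — `X^{[n]}` is a `2n`-dimensional irreducible smooth variety."
  Over `ℂ` irreducible = geometrically irreducible, so the conclusion is EXACTLY the tree's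
  `IsSmoothProjective (2 * n) H`.
* PROVED `nonempty_hilbertSchemesOfPoints` — a full choice `H : HilbertSchemesOfPoints S` exists (the fact + choice).
* PROVED, fact-free: `HilbertSchemesOfPoints.override` — replacing the `m`-th member of a full choice by ANY given
  Hilbert scheme `(H′, Ξ′)` of `m` points (smooth projective of dimension `2m`) is again a full choice, with
  `(override …).obj m = H′` and `(override …).fam m ≍ Ξ′` (`override_obj_self`, `override_fam_self`,
  `override_obj_of_ne`, `override_fam_of_ne`); hence `exists_obj_eq`.
* PROVED (modulo the fact) `IsGeneralizedKummerVarietyOf.exists_hilbertSchemesOfPoints` — **a generalized Kummer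
  variety `K` of an abelian surface `A` (by definition a Kummer fibre of SOME Hilbert-scheme model of `n + 1`
  points) is a Kummer fibre of the `(n+1)`-st member of some FULL choice `H : HilbertSchemesOfPoints A.X`**, with
  the same Albanese datum, base point and inclusion — the instance seam of a Fock-space argument about `K`.

## Sources (read)

* [Lehn1999] M. Lehn, Invent. Math. 136 (1999) (arXiv:math/9803091), §1.1 and Thm. 1.1 p. 5 (quoted above).
* [Nitsure2005] N. Nitsure, Construction of Hilbert and Quot schemes (arXiv:math/0504590), Thm. 5.1
  (Grothendieck) p. 16 (quoted above).
* [Fogarty1968] J. Fogarty, Algebraic families on an algebraic surface, Amer. J. Math. 90 (1968) 511–521,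
  Thm. 2.4 — cited through Lehn's restatement (the original is not held: acquisition request filed).
* [GrothendieckFGA] A. Grothendieck, FGA, Sém. Bourbaki 221 — cited through Lehn and Nitsure.

## Design

The fact is stated over `ℂ` (every consumer lives there); `-- TODO(general form):` any field `k` (Fogarty: any
field; geometric irreducibility by base change).  It quantifies over one `n` at a time (the printed form); the
full choice is assembled by the axiom of choice (`nonempty_hilbertSchemesOfPoints`).  The override is a real
definition by cases on `k = m` with the family transported along the defining equalities of the `if`
(`famCast`); nothing about `H′` is assumed beyond the two clauses of the structure.
-/

noncomputable section

open CategoryTheory MonoidalCategory CartesianMonoidalCategory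
open Literature.AlgebraicGeometry.Motives (SchemeOver IsSmoothProjective AbelianVariety)
open scoped MonObj

namespace Literature.AlgebraicGeometry.HilbertScheme

/-! ### The named fact -/

/-- **Grothendieck's existence theorem and Fogarty's theorem for the Hilbert scheme of points of a smooth
projective surface.**  For every smooth projective complex surface `S` and every `n ≥ 0` there is a `ℂ`-scheme
`H` with a universal family `Ξ ⊂ S × H` representing the Hilbert functor of `n` points of `S`
(`IsHilbertSchemeOfPoints n S H Ξ`), and `H = S^[n]` is smooth projective, irreducible, of dimension `2n`:
"By a result of Grothendieck `X^{[n]}` is again a projective scheme. […] Theorem 1.1 (Fogarty). — `X^{[n]}` is a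
`2n`-dimensional irreducible smooth variety."  A THEOREM in print, unproved in the tree.
-- TODO(general form): any ground field (Fogarty: smooth quasi-projective surface over a field).
[cite: Fogarty1968, Thm. 2.4] [cite: Lehn1999, §1.1 and Thm. 1.1 (p. 5)] [cite: Nitsure2005, Thm. 5.1 (Grothendieck)]
[cite: GrothendieckFGA, Sém. Bourbaki exp. 221 (les schémas de Hilbert)] -/
def Fogarty1968_hilbertScheme_surface : Prop :=
  ∀ ⦃S : SchemeOver ℂ⦄, IsSmoothProjective 2 S → ∀ n : ℕ,
    ∃ (H : SchemeOver ℂ) (Ξ : (S ⊗ H).left.IdealSheafData),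
      IsHilbertSchemeOfPoints n S H Ξ ∧ IsSmoothProjective (2 * n) H

variable {S : SchemeOver ℂ}

/-- **A full choice of Hilbert schemes of points exists** for a smooth projective complex surface (the fact, one
`n` at a time, assembled by choice). [cite: Lehn1999, §1.1 and Thm. 1.1 (p. 5)] -/
theorem nonempty_hilbertSchemesOfPoints (hGF : Fogarty1968_hilbertScheme_surface) (hS : IsSmoothProjective 2 S) :
    Nonempty (HilbertSchemesOfPoints S) := by
  choose H Ξ hH hsm using hGF hS
  exact ⟨⟨H, Ξ, hH, hsm⟩⟩

/-! ### Overriding one member of a full choice (fact-free) -/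

namespace HilbertSchemesOfPoints

/-- Transport of a family `Ξ ⊂ S × H₁` along an equality `H₂ = H₁` of parameter schemes (plumbing). [folklore] -/
def famCast {H₁ H₂ : SchemeOver ℂ} (e : H₂ = H₁) (Ξ : (S ⊗ H₁).left.IdealSheafData) :
    (S ⊗ H₂).left.IdealSheafData :=
  e ▸ Ξ

/-- The transported family is the original one (heterogeneously; plumbing). [folklore] -/
private theorem famCast_heq {H₁ H₂ : SchemeOver ℂ} (e : H₂ = H₁) (Ξ : (S ⊗ H₁).left.IdealSheafData) :
    HEq (famCast e Ξ) Ξ := by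
  subst e
  rfl

/-- Representing the Hilbert functor is invariant under the transport (plumbing). [folklore] -/
private theorem isHilbertSchemeOfPoints_famCast {m : ℕ} {H₁ H₂ : SchemeOver ℂ} (e : H₂ = H₁)
    {Ξ : (S ⊗ H₁).left.IdealSheafData} (h : IsHilbertSchemeOfPoints m S H₁ Ξ) :
    IsHilbertSchemeOfPoints m S H₂ (famCast e Ξ) := by
  subst e
  exact h

/-- **Overriding the `m`-th member of a full choice of Hilbert schemes of points** by a given Hilbert scheme
`(H′, Ξ′)` of `m` points of `S`, smooth projective of dimension `2m`: again a full choice (the other members are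
kept). [cite: Lehn1999, Thm. 1.1 (p. 5)] -/
def override (H : HilbertSchemesOfPoints S) (m : ℕ) (H' : SchemeOver ℂ) (Ξ' : (S ⊗ H').left.IdealSheafData)
    (hH' : IsHilbertSchemeOfPoints m S H' Ξ') (hsm : IsSmoothProjective (2 * m) H') : HilbertSchemesOfPoints S where
  obj k := if k = m then H' else H.obj k
  fam k := if h : k = m then famCast (if_pos h) Ξ' else famCast (if_neg h) (H.fam k)
  isHilbertScheme k := by
    by_cases h : k = m
    · rw [dif_pos h]
      subst h
      exact isHilbertSchemeOfPoints_famCast _ hH'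
    · rw [dif_neg h]
      exact isHilbertSchemeOfPoints_famCast _ (H.isHilbertScheme k)
  smooth k := by
    split_ifs with h
    · subst h
      exact hsm
    · exact H.smooth k

variable (H : HilbertSchemesOfPoints S) (m : ℕ) (H' : SchemeOver ℂ) (Ξ' : (S ⊗ H').left.IdealSheafData)
  (hH' : IsHilbertSchemeOfPoints m S H' Ξ') (hsm : IsSmoothProjective (2 * m) H')

/-- The overridden member IS the given scheme. [cite: Lehn1999, Thm. 1.1 (p. 5)] -/
@[simp]
theorem override_obj_self : (H.override m H' Ξ' hH' hsm).obj m = H' :=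
  if_pos rfl

/-- The overridden family IS the given family (heterogeneously, over `override_obj_self`).
[cite: Lehn1999, Thm. 1.1 (p. 5)] -/
theorem override_fam_self : HEq ((H.override m H' Ξ' hH' hsm).fam m) Ξ' := by
  have h : (H.override m H' Ξ' hH' hsm).fam m = famCast (if_pos rfl) Ξ' := dif_pos rfl
  rw [h]
  exact famCast_heq _ _

/-- The other members are unchanged. [cite: Lehn1999, Thm. 1.1 (p. 5)] -/
theorem override_obj_of_ne {k : ℕ} (hk : k ≠ m) : (H.override m H' Ξ' hH' hsm).obj k = H.obj k :=
  if_neg hk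

/-- The other families are unchanged (heterogeneously, over `override_obj_of_ne`). [cite: Lehn1999, Thm. 1.1 (p. 5)] -/
theorem override_fam_of_ne {k : ℕ} (hk : k ≠ m) : HEq ((H.override m H' Ξ' hH' hsm).fam k) (H.fam k) := by
  have h : (H.override m H' Ξ' hH' hsm).fam k = famCast (if_neg hk) (H.fam k) := dif_neg hk
  rw [h]
  exact famCast_heq _ _

/-- **Any Hilbert scheme of `m` points is the `m`-th member of some full choice**, given one full choice.
[cite: Lehn1999, Thm. 1.1 (p. 5)] -/
theorem exists_obj_eq (H : HilbertSchemesOfPoints S) {m : ℕ} {H' : SchemeOver ℂ}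
    {Ξ' : (S ⊗ H').left.IdealSheafData} (hH' : IsHilbertSchemeOfPoints m S H' Ξ')
    (hsm : IsSmoothProjective (2 * m) H') :
    ∃ H₁ : HilbertSchemesOfPoints S, H₁.obj m = H' ∧ HEq (H₁.fam m) Ξ' :=
  ⟨H.override m H' Ξ' hH' hsm, override_obj_self H m H' Ξ' hH' hsm, override_fam_self H m H' Ξ' hH' hsm⟩

end HilbertSchemesOfPoints

/-- **Any Hilbert scheme of `m` points of a smooth projective surface is the `m`-th member of some full choice**
(the fact gives one full choice; override its `m`-th member). [cite: Lehn1999, §1.1 and Thm. 1.1 (p. 5)] -/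
theorem exists_hilbertSchemesOfPoints_obj_eq (hGF : Fogarty1968_hilbertScheme_surface) (hS : IsSmoothProjective 2 S)
    {m : ℕ} {H' : SchemeOver ℂ} {Ξ' : (S ⊗ H').left.IdealSheafData} (hH' : IsHilbertSchemeOfPoints m S H' Ξ')
    (hsm : IsSmoothProjective (2 * m) H') :
    ∃ H : HilbertSchemesOfPoints S, H.obj m = H' ∧ HEq (H.fam m) Ξ' := by
  obtain ⟨H⟩ := nonempty_hilbertSchemesOfPoints hGF hS
  exact H.exists_obj_eq hH' hsm

/-! ### The instance seam for generalized Kummer varieties -/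

/-- **A generalized Kummer variety of an abelian surface is a Kummer fibre of a member of a FULL choice of
Hilbert schemes of points.**  If `K` is a generalized Kummer variety of `A` in the tree's sense (a fibre
`j : K ⟶ H₀` over the unit section of `alb − alb(x₀) : H₀ ⟶ Alb(H₀)` for SOME Hilbert scheme `H₀` of `n + 1` points of
`A`), then there are a full choice `H : HilbertSchemesOfPoints A.X` — so that `⨁ₘ H*(H.obj m)` carries the Heisenberg
/ Chern-character operators — an Albanese datum of `H.obj (n + 1)`, a base point and `j : K ⟶ H.obj (n + 1)` with the
same defining pullback square.  (Override the `(n+1)`-st member of any full choice by `H₀`; modulo the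
Grothendieck–Fogarty existence fact; `hS` = "`A` is a surface", e.g. `hA ▸ AbelianVariety.isSmoothProjective_holds`
from `A.dim = 2`.) [cite: Beauville1983, §7 p. 769 (definition of K_r)] [cite: Lehn1999, §1.1 and Thm. 1.1 (p. 5)] -/
theorem _root_.Literature.AlgebraicGeometry.Hyperkaehler.IsGeneralizedKummerVarietyOf.exists_hilbertSchemesOfPoints
    (hGF : Fogarty1968_hilbertScheme_surface) {n : ℕ} {A : AbelianVariety ℂ} {K : SchemeOver ℂ}
    (hS : IsSmoothProjective 2 A.X) (hK : Hyperkaehler.IsGeneralizedKummerVarietyOf n A K) :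
    ∃ (H : HilbertSchemesOfPoints A.X) (𝒜 : Motives.Jacobian (H.obj (n + 1)))
      (x₀ : 𝟙_ (SchemeOver ℂ) ⟶ H.obj (n + 1)) (j : K ⟶ H.obj (n + 1)),
      IsPullback j (toUnit K) (lift (𝟙 (H.obj (n + 1))) (toUnit (H.obj (n + 1)) ≫ x₀) ≫ 𝒜.diff)
        (1 : 𝟙_ (SchemeOver ℂ) ⟶ 𝒜.J.X) := by
  obtain ⟨H₀, Ξ₀, 𝒜, x₀, j, hHilb, hsm, hsq⟩ := hK
  obtain ⟨H, hobj, -⟩ := exists_hilbertSchemesOfPoints_obj_eq hGF hS hHilb hsm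
  subst hobj
  exact ⟨H, 𝒜, x₀, j, hsq⟩

end Literature.AlgebraicGeometry.HilbertScheme

end
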